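import Summits.AtomisticToContinuum.HydrodynamicLimit.Theorems.TwoClocksEquilibriumFastWindowLDBirthT12CircleIterate
import Literature.Analysis.SpecialFunctions.LegendreHilbertBasis
import HarnessLib

/-!
# Iterated zonal operators on `S²`, I: the Legendre series of the weight in `L¹[-1, 1]`, symmetry and
# linearity of the iterates, their action on Legendre partial sums
# (helper `t12_legendre_series_L1` of the line `birth`, crux `TwoClocks.EquilibriumFastWindowLD`,
# stmt-AtomisticToContinuum-14440; §6 FF2/FF3/FF4-junction infrastructure towards the registered analytic
# sub-goal `t12_logLinearPreimage_and_dipoleModulus`; the contraction theorem itself is in the sibling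
# file `…T12FarFieldContractionB`)

Plan §6 of the sub-goal bounds the `j`-fold far-field iterate `K^j` of a zonal operator
`(K F)(x) = ∫_{S²} k(⟪x, ω⟫) F(ω) dσ(ω)` on the sector `ℓ ≥ 2` of `L^∞(S²)` (profiles with zero zonal average
and zero dipole moment) by the Legendre number `θ_j ≤ Σ_{ℓ≥2} (2ℓ+1)/2 ‖P_ℓ‖_{L¹} |λ_ℓ|^j`, `λ_ℓ = 2π∫_{-1}^{1} k P_ℓ`
the Funk–Hecke multipliers (`t12_funkHecke_legendre`, `t12_iterate_zonal_legendre`), certified for the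
normalised far-field step `k = (2/π)x₊²` in `…T12LegendreCertificate` (`θ₈ ≤ 2/3`) and `…T12LegendreMoments`
(`θ₆ ≤ 1/2`). The proof never forms the kernel of `K^j`: by the SYMMETRY of `K`,
`(K^j Y)(n) = ∫ (K^{j-1} k(⟪n, ·⟫))(ω) Y(ω) dσ(ω)`, and `K^{j-1}` is applied to the Legendre SERIES of the pole
function `k(⟪n, ·⟫) = Σ_ℓ (2ℓ+1)/2 (∫ k P_ℓ) P_ℓ(⟪n, ·⟫)` mode by mode. This file supplies the pieces:

* **`tendsto_integral_abs_sub_legendreSum`** (registered `t12_legendre_series_L1`) — for `k` measurable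
  with `|k| ≤ M` on `[-1, 1]`: `∫_{-1}^{1} |k − Σ_{ℓ<L} (2ℓ+1)/2 (∫_{-1}^{1} k P_ℓ) P_ℓ| → 0` as `L → ∞` — the
  Legendre series converges in `L¹[-1, 1]` (Hilbert basis `legendreBasis` of
  `Literature…LegendreHilbertBasis`: `L²` convergence of the partial sums, which are the classes of the
  polynomials `Σ (2ℓ+1)/2 (∫ k P_ℓ) P_ℓ`, then `‖·‖_{L¹} ≤ √2 ‖·‖_{L²}` on `[-1, 1]`);
* `integral_sphere_zonalOp_mul_comm`, `integral_sphere_iterate_zonalOp_mul_comm` — symmetry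
  `∫ (K^i F) G dσ = ∫ F (K^i G) dσ` for bounded measurable `F, G` (Fubini on `S² × S²`);
* `iterate_zonalOp_add_smul`, `iterate_zonalOp_zero` — linearity of `K^i` on the unit sphere;
* `iterate_zonalOp_legendreSum` — `K^i (Σ_{ℓ<L} a_ℓ P_ℓ(⟪n, ·⟫)) = Σ_{ℓ<L} a_ℓ λ_ℓ^i P_ℓ(⟪n, ·⟫)` on the sphere.

The operator is passed as a variable `K` with its defining equation `hK` (instantiated by `rfl`; no new
definition). All statements are [folklore] (Legendre 1785; Funk 1916 / Hecke 1918).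
-/

noncomputable section

open MeasureTheory Real Set Filter Metric Polynomial Topology
open scoped ENNReal BigOperators InnerProductSpace
namespace Summit.AtomisticToContinuum.HydrodynamicLimit.Theorems.ClampedCorrectorBirth

open Literature.Analysis.FluidPDE Literature.MathematicalPhysics.KineticTheory
  Literature.Analysis.SpecialFunctions

/-! ### The Legendre series of a bounded measurable function converges in `L¹[-1, 1]` -/


/-- **The Legendre series of a bounded measurable function converges in `L¹[-1, 1]`**:
`∫_{-1}^{1} |k - Σ_{l<L} (2l+1)/2 (∫ k P_l) P_l| → 0` (completeness of the Legendre polynomials in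
`L²[-1, 1]`, `legendreBasis`, and `‖·‖_{L¹} ≤ √2 ‖·‖_{L²}` on `[-1, 1]`). [folklore] -/
theorem tendsto_integral_abs_sub_legendreSum {k : ℝ → ℝ} (hk : Measurable k) {M : ℝ}
    (hM : ∀ t ∈ Icc (-1:ℝ) 1, |k t| ≤ M) :
    Tendsto (fun L : ℕ => ∫ t in (-1:ℝ)..1,
      |k t - ∑ l ∈ Finset.range L, (2 * (l : ℝ) + 1) / 2 * (∫ z in (-1:ℝ)..1, k z * (legendre l).eval z) *
        (legendre l).eval t|) atTop (𝓝 0) := by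
  set a : ℕ → ℝ := fun l => (2 * (l : ℝ) + 1) / 2 * ∫ z in (-1:ℝ)..1, k z * (legendre l).eval z with ha
  -- the `L²` class of `k`
  have hkm : AEStronglyMeasurable (fun t => ((k t : ℝ) : ℂ)) legendreMeasure :=
    (Complex.continuous_ofReal.measurable.comp hk).aestronglyMeasurable
  have hk2 : MemLp (fun t => ((k t : ℝ) : ℂ)) 2 legendreMeasure :=
    (memLp_top_of_bound hkm M (ae_legendreMeasure_of_forall_mem fun t ht => by
      rw [Complex.norm_real, Real.norm_eq_abs]; exact hM t ht)).mono_exponent le_top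
  set f : Lp ℂ 2 legendreMeasure := hk2.toLp _ with hf
  -- the partial sums are the classes of the polynomials `p L = Σ_{l<L} a_l P_l`
  set p : ℕ → ℝ[X] := fun L => ∑ l ∈ Finset.range L, C (a l) * legendre l with hp
  have hpe : ∀ (L : ℕ) (t : ℝ), (p L).eval t = ∑ l ∈ Finset.range L, a l * (legendre l).eval t :=
    fun L t => by simp only [hp, eval_finsetSum, eval_mul, eval_C]
  have hrepr : ∀ l, legendreBasis.repr f l =
      ((legendreNormConst l * ∫ z in (-1:ℝ)..1, k z * (legendre l).eval z : ℝ) : ℂ) := by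
    intro l
    rw [legendreBasis_repr]
    have h1 : (fun x => (starRingEnd ℂ) (legendreFn l x) * f x) =ᵐ[legendreMeasure]
        fun x => ((legendreNormConst l * (k x * (legendre l).eval x) : ℝ) : ℂ) := by
      filter_upwards [hk2.coeFn_toLp] with x hx
      rw [hx, conj_legendreFn, legendreFn_apply, ← Complex.ofReal_mul]
      push_cast
      ring
    rw [integral_congr_ae h1, integral_complex_ofReal, integral_legendreMeasure_eq_intervalIntegral,
      intervalIntegral.integral_const_mul]
  have hsum : ∀ L, ∑ l ∈ Finset.range L, legendreBasis.repr f l • legendreBasis l = polynomialL2 (p L) := by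
    intro L
    refine Lp.ext ?_
    filter_upwards [coeFn_polynomialL2 (p L), ae_forall_coeFn_legendreL2,
      Lp.coeFn_fun_finsetSum (Finset.range L) (fun l => legendreBasis.repr f l • legendreBasis l),
      ae_all_iff.2 fun l => Lp.coeFn_smul (legendreBasis.repr f l) (legendreBasis l)]
      with x hx hleg hS hsmul
    rw [hS, hx, hpe, Complex.ofReal_sum]
    refine Finset.sum_congr rfl fun l _ => ?_
    rw [hsmul l, Pi.smul_apply, legendreBasis_apply, hleg l, legendreFn_apply, hrepr l, smul_eq_mul,
      ← Complex.ofReal_mul, ha]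
    push_cast
    have h2 : ((legendreNormConst l : ℝ) : ℂ) * legendreNormConst l = (2 * (l : ℂ) + 1) / 2 := by
      rw [← Complex.ofReal_mul, ← sq, legendreNormConst_sq]
      push_cast
      ring
    linear_combination ((∫ z in (-1:ℝ)..1, k z * (legendre l).eval z : ℝ) : ℂ) *
      (((legendre l).eval x : ℝ) : ℂ) * h2
  -- `L²` convergence of the partial sums
  have hT : Tendsto (fun L => polynomialL2 (p L)) atTop (𝓝 f) := by
    have h := (legendreBasis.hasSum_repr f).tendsto_sum_nat
    simp_rw [hsum] at h
    exact h
  have hT2 : Tendsto (fun L => eLpNorm ((fun t => (((p L).eval t : ℝ) : ℂ)) - fun t => ((k t : ℝ) : ℂ))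
      2 legendreMeasure) atTop (𝓝 0) :=
    (Lp.tendsto_Lp_iff_tendsto_eLpNorm'' _ (fun L => memLp_legendreMeasure_of_continuous
      (Complex.continuous_ofReal.comp (p L).continuous) 2) _ hk2).1 hT
  -- `L¹ ≤ √2 L²` on `[-1, 1]`
  set r : ℕ → ℝ → ℝ := fun L t => k t - ∑ l ∈ Finset.range L, a l * (legendre l).eval t with hr
  have hrm : ∀ L, AEStronglyMeasurable (r L) legendreMeasure := fun L =>
    (hk.sub (p L).continuous.measurable |>.aestronglyMeasurable).congr
      (Eventually.of_forall fun t => by simp only [hr, Pi.sub_apply, hpe])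
  have hE2 : ∀ L, eLpNorm (r L) 2 legendreMeasure =
      eLpNorm ((fun t => (((p L).eval t : ℝ) : ℂ)) - fun t => ((k t : ℝ) : ℂ)) 2 legendreMeasure := by
    intro L
    refine eLpNorm_congr_norm_ae (Eventually.of_forall fun t => ?_)
    rw [Pi.sub_apply, ← Complex.ofReal_sub, Complex.norm_real, hr, Real.norm_eq_abs, Real.norm_eq_abs,
      hpe, abs_sub_comm]
  have hE1 : ∀ L, eLpNorm (r L) 1 legendreMeasure ≤
      eLpNorm (r L) 2 legendreMeasure * (legendreMeasure univ) ^ (1 / (1:ℝ≥0∞).toReal - 1 / (2:ℝ≥0∞).toReal) :=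
    fun L => eLpNorm_le_eLpNorm_mul_rpow_measure_univ (by norm_num) (hrm L)
  have hT1 : Tendsto (fun L => eLpNorm (r L) 1 legendreMeasure) atTop (𝓝 0) := by
    have h0 : Tendsto (fun L => eLpNorm (r L) 2 legendreMeasure *
        (legendreMeasure univ) ^ (1 / (1:ℝ≥0∞).toReal - 1 / (2:ℝ≥0∞).toReal)) atTop (𝓝 0) := by
      rw [← zero_mul ((legendreMeasure univ) ^ (1 / (1:ℝ≥0∞).toReal - 1 / (2:ℝ≥0∞).toReal))]
      refine ENNReal.Tendsto.mul_const ?_ (Or.inr ?_)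
      · simp_rw [hE2]; exact hT2
      · rw [legendreMeasure_univ]
        exact ENNReal.rpow_ne_top_of_nonneg (by norm_num) (by norm_num)
    exact tendsto_of_tendsto_of_tendsto_of_le_of_le tendsto_const_nhds h0 (fun _ => zero_le) hE1
  -- back to real integrals
  have hI : ∀ L, ∫ t in (-1:ℝ)..1, |r L t| = (eLpNorm (r L) 1 legendreMeasure).toReal := by
    intro L
    rw [← integral_legendreMeasure_eq_intervalIntegral, eLpNorm_one_eq_lintegral_enorm,
      ← integral_norm_eq_lintegral_enorm (hrm L)]
    rfl
  have h := (ENNReal.tendsto_toReal ENNReal.zero_ne_top).comp hT1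
  rw [ENNReal.toReal_zero] at h
  refine h.congr fun L => ?_
  rw [Function.comp_apply, ← hI]


/-! ### Bounded zonal weights -/

/-- A measurable weight bounded on `[-1, 1]` is integrable there. [folklore] -/
theorem intervalIntegrable_of_abs_le_on_Icc {k : ℝ → ℝ} (hk : Measurable k) {M : ℝ}
    (hM : ∀ t ∈ Icc (-1:ℝ) 1, |k t| ≤ M) : IntervalIntegrable k volume (-1) 1 :=
  (intervalIntegrable_iff_integrableOn_Icc_of_le (by norm_num)).2
    (Measure.integrableOn_of_bounded (by rw [Real.volume_Icc]; exact ENNReal.ofReal_ne_top)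
      hk.aestronglyMeasurable (ae_legendreMeasure_of_forall_mem fun t ht => by
        rw [Real.norm_eq_abs]; exact hM t ht))

/-- The height `⟪n, x⟫` of two unit vectors lies in `[-1, 1]`. [folklore] -/
theorem inner_mem_Icc_of_norm_eq_one {n x : EuclideanSpace ℝ (Fin 3)} (hn : ‖n‖ = 1) (hx : ‖x‖ = 1) :
    ⟪n, x⟫_ℝ ∈ Icc (-1:ℝ) 1 := by
  have h := abs_real_inner_le_norm n x
  rw [hn, hx, mul_one] at h
  exact abs_le.1 h

/-- A measurable function bounded on the unit sphere is `σ`-integrable there. [folklore] -/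
theorem integrable_sphere_of_abs_le {F : EuclideanSpace ℝ (Fin 3) → ℝ} (hF : Measurable F) {m : ℝ}
    (hm : ∀ x : EuclideanSpace ℝ (Fin 3), ‖x‖ = 1 → |F x| ≤ m) :
    Integrable (fun ω : sphere (0 : EuclideanSpace ℝ (Fin 3)) 1 => F ω) sphereMeasure := by
  haveI := isFiniteMeasure_sphereMeasure (E := EuclideanSpace ℝ (Fin 3))
  exact (integrable_const m).mono' (hF.comp continuous_subtype_val.measurable).aestronglyMeasurable
    (Eventually.of_forall fun ω => by rw [Real.norm_eq_abs]; exact hm _ (by simp))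

/-- Duality on the sphere: `|∫ F Y dσ| ≤ m ∫ |F| dσ` for `|Y| ≤ m`. [folklore] -/
theorem abs_integral_sphere_mul_le {F Y : EuclideanSpace ℝ (Fin 3) → ℝ} (hF : Measurable F) {mF : ℝ}
    (hmF : ∀ x : EuclideanSpace ℝ (Fin 3), ‖x‖ = 1 → |F x| ≤ mF) {m : ℝ}
    (hm : ∀ x : EuclideanSpace ℝ (Fin 3), ‖x‖ = 1 → |Y x| ≤ m) :
    |∫ ω : sphere (0 : EuclideanSpace ℝ (Fin 3)) 1, F ω * Y ω ∂sphereMeasure| ≤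
      m * ∫ ω : sphere (0 : EuclideanSpace ℝ (Fin 3)) 1, |F ω| ∂sphereMeasure := by
  calc |∫ ω : sphere (0 : EuclideanSpace ℝ (Fin 3)) 1, F ω * Y ω ∂sphereMeasure|
      ≤ ∫ ω : sphere (0 : EuclideanSpace ℝ (Fin 3)) 1, |F ω * Y ω| ∂sphereMeasure := abs_integral_le_integral_abs
    _ ≤ ∫ ω : sphere (0 : EuclideanSpace ℝ (Fin 3)) 1, |F ω| * m ∂sphereMeasure := by
        refine integral_mono_of_nonneg (Eventually.of_forall fun ω => abs_nonneg _)
          ((integrable_sphere_of_abs_le hF hmF).abs.mul_const m) (Eventually.of_forall fun ω => ?_)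
        dsimp only
        rw [abs_mul]
        exact mul_le_mul_of_nonneg_left (hm _ (by simp)) (abs_nonneg _)
    _ = m * ∫ ω : sphere (0 : EuclideanSpace ℝ (Fin 3)) 1, |F ω| ∂sphereMeasure := by
        rw [integral_mul_const, mul_comm]

/-! ### The zonal operator `K`: symmetry and linearity of its iterates -/

section ZonalOp

variable {k : ℝ → ℝ} {M : ℝ} {K : (EuclideanSpace ℝ (Fin 3) → ℝ) → EuclideanSpace ℝ (Fin 3) → ℝ}
  (hK : K = fun (F : EuclideanSpace ℝ (Fin 3) → ℝ) (x : EuclideanSpace ℝ (Fin 3)) =>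
    ∫ ω : sphere (0 : EuclideanSpace ℝ (Fin 3)) 1, k ⟪x, (ω : EuclideanSpace ℝ (Fin 3))⟫_ℝ * F ω ∂sphereMeasure)
include hK

/-- **Symmetry of a zonal step**: `∫ (K F) G dσ = ∫ F (K G) dσ` for bounded measurable `F, G` and a
weight `k` bounded on `[-1, 1]` (Fubini on `S² × S²`, `k(⟪ω, ω'⟫) = k(⟪ω', ω⟫)`). [folklore] -/
theorem integral_sphere_zonalOp_mul_comm (hk : Measurable k) (hM : ∀ t ∈ Icc (-1:ℝ) 1, |k t| ≤ M)
    {F G : EuclideanSpace ℝ (Fin 3) → ℝ} (hF : Measurable F) (hG : Measurable G) {mF mG : ℝ}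
    (hmF : ∀ x : EuclideanSpace ℝ (Fin 3), ‖x‖ = 1 → |F x| ≤ mF)
    (hmG : ∀ x : EuclideanSpace ℝ (Fin 3), ‖x‖ = 1 → |G x| ≤ mG) :
    ∫ ω : sphere (0 : EuclideanSpace ℝ (Fin 3)) 1, K F ω * G ω ∂sphereMeasure =
      ∫ ω : sphere (0 : EuclideanSpace ℝ (Fin 3)) 1, F ω * K G ω ∂sphereMeasure := by
  subst hK
  haveI := isFiniteMeasure_sphereMeasure (E := EuclideanSpace ℝ (Fin 3))
  have hint : Integrable (Function.uncurry fun (ω : sphere (0 : EuclideanSpace ℝ (Fin 3)) 1)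
      (ω' : sphere (0 : EuclideanSpace ℝ (Fin 3)) 1) =>
      k ⟪(ω : EuclideanSpace ℝ (Fin 3)), (ω' : EuclideanSpace ℝ (Fin 3))⟫_ℝ * F ω' * G ω)
      ((sphereMeasure : Measure (sphere (0 : EuclideanSpace ℝ (Fin 3)) 1)).prod sphereMeasure) := by
    refine (integrable_const (M * mF * mG)).mono' ?_ (Eventually.of_forall fun p => ?_)
    · have h1 : Measurable fun p : sphere (0 : EuclideanSpace ℝ (Fin 3)) 1 × sphere (0 : EuclideanSpace ℝ (Fin 3)) 1 =>
          ⟪(p.1 : EuclideanSpace ℝ (Fin 3)), (p.2 : EuclideanSpace ℝ (Fin 3))⟫_ℝ :=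
        ((continuous_subtype_val.comp continuous_fst).inner
          (continuous_subtype_val.comp continuous_snd)).measurable
      exact (((hk.comp h1).mul (hF.comp (continuous_subtype_val.comp continuous_snd).measurable)).mul
        (hG.comp (continuous_subtype_val.comp continuous_fst).measurable)).aestronglyMeasurable
    · rw [Function.uncurry_def, Real.norm_eq_abs, abs_mul, abs_mul]
      have hp1 : ‖(p.1 : EuclideanSpace ℝ (Fin 3))‖ = 1 := by simp
      have hp2 : ‖(p.2 : EuclideanSpace ℝ (Fin 3))‖ = 1 := by simp
      have h0 : 0 ≤ M := (abs_nonneg _).trans (hM _ (inner_mem_Icc_of_norm_eq_one hp1 hp2))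
      have h0F : 0 ≤ mF := (abs_nonneg _).trans (hmF _ hp2)
      exact mul_le_mul (mul_le_mul (hM _ (inner_mem_Icc_of_norm_eq_one hp1 hp2)) (hmF _ hp2)
        (abs_nonneg _) h0) (hmG _ hp1) (abs_nonneg _) (mul_nonneg h0 h0F)
  calc ∫ ω : sphere (0 : EuclideanSpace ℝ (Fin 3)) 1, (∫ ω' : sphere (0 : EuclideanSpace ℝ (Fin 3)) 1,
        k ⟪(ω : EuclideanSpace ℝ (Fin 3)), (ω' : EuclideanSpace ℝ (Fin 3))⟫_ℝ * F ω' ∂sphereMeasure) * G ω ∂sphereMeasure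
      = ∫ ω : sphere (0 : EuclideanSpace ℝ (Fin 3)) 1, ∫ ω' : sphere (0 : EuclideanSpace ℝ (Fin 3)) 1,
          k ⟪(ω : EuclideanSpace ℝ (Fin 3)), (ω' : EuclideanSpace ℝ (Fin 3))⟫_ℝ * F ω' * G ω ∂sphereMeasure ∂sphereMeasure :=
        integral_congr_ae (Eventually.of_forall fun ω => (integral_mul_const _ _).symm)
    _ = ∫ ω' : sphere (0 : EuclideanSpace ℝ (Fin 3)) 1, ∫ ω : sphere (0 : EuclideanSpace ℝ (Fin 3)) 1,
          k ⟪(ω : EuclideanSpace ℝ (Fin 3)), (ω' : EuclideanSpace ℝ (Fin 3))⟫_ℝ * F ω' * G ω ∂sphereMeasure ∂sphereMeasure :=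
        integral_integral_swap hint
    _ = _ := by
        refine integral_congr_ae (Eventually.of_forall fun ω' => ?_)
        dsimp only
        rw [← integral_const_mul]
        refine integral_congr_ae (Eventually.of_forall fun ω => ?_)
        dsimp only
        rw [real_inner_comm]
        ring

/-- The iterates inherit the symmetry: `∫ (K^i F) G dσ = ∫ F (K^i G) dσ`. [folklore] -/
theorem integral_sphere_iterate_zonalOp_mul_comm (hk : Measurable k) (hM : ∀ t ∈ Icc (-1:ℝ) 1, |k t| ≤ M)
    (i : ℕ) : ∀ {F G : EuclideanSpace ℝ (Fin 3) → ℝ}, Measurable F → Measurable G → ∀ {mF mG : ℝ},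
      (∀ x : EuclideanSpace ℝ (Fin 3), ‖x‖ = 1 → |F x| ≤ mF) →
      (∀ x : EuclideanSpace ℝ (Fin 3), ‖x‖ = 1 → |G x| ≤ mG) →
      ∫ ω : sphere (0 : EuclideanSpace ℝ (Fin 3)) 1, (K^[i] F) ω * G ω ∂sphereMeasure =
        ∫ ω : sphere (0 : EuclideanSpace ℝ (Fin 3)) 1, F ω * (K^[i] G) ω ∂sphereMeasure := by
  have hkI := intervalIntegrable_of_abs_le_on_Icc hk hM
  induction i with
  | zero => intros; rfl
  | succ i ih =>
    intro F G hF hG mF mG hmF hmG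
    have hKF : Measurable (K F) := by subst hK; exact measurable_integral_sphere_zonal_mul hk hF
    have hbKF : ∀ x : EuclideanSpace ℝ (Fin 3), ‖x‖ = 1 → |K F x| ≤ (2 * π * ∫ t in (-1:ℝ)..1, |k t|) * mF := by
      subst hK; exact fun x hx => abs_integral_sphere_zonal_mul_le hx hkI hmF
    have hKiG : Measurable (K^[i] G) := by subst hK; exact measurable_iterate_sphere_zonal hk hG i
    have hbKiG : ∀ x : EuclideanSpace ℝ (Fin 3), ‖x‖ = 1 →
        |(K^[i] G) x| ≤ (2 * π * ∫ t in (-1:ℝ)..1, |k t|) ^ i * mG := by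
      subst hK; exact abs_iterate_sphere_zonal_le hkI hmG i
    rw [Function.iterate_succ_apply, Function.iterate_succ_apply', ih hKF hG hbKF hmG]
    exact integral_sphere_zonalOp_mul_comm hK hk hM hF hKiG hmF hbKiG

/-- The iterates of `K` kill the zero profile. [folklore] -/
theorem iterate_zonalOp_zero (i : ℕ) : ∀ x : EuclideanSpace ℝ (Fin 3), (K^[i] (fun _ => 0)) x = 0 := by
  subst hK
  induction i with
  | zero => intro x; rfl
  | succ i ih =>
    intro x
    rw [Function.iterate_succ_apply']
    simp only [ih, mul_zero, integral_zero]

/-- **Linearity of the iterates on the unit sphere**: `K^i (F + c G) = K^i F + c K^i G` there, for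
bounded measurable `F, G` (off the sphere the values are never used). [folklore] -/
theorem iterate_zonalOp_add_smul (hk : Measurable k) (hM : ∀ t ∈ Icc (-1:ℝ) 1, |k t| ≤ M) (i : ℕ) :
    ∀ {F G : EuclideanSpace ℝ (Fin 3) → ℝ}, Measurable F → Measurable G → ∀ {mF mG : ℝ},
      (∀ x : EuclideanSpace ℝ (Fin 3), ‖x‖ = 1 → |F x| ≤ mF) →
      (∀ x : EuclideanSpace ℝ (Fin 3), ‖x‖ = 1 → |G x| ≤ mG) → ∀ (c : ℝ) (x : EuclideanSpace ℝ (Fin 3)),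
      ‖x‖ = 1 → (K^[i] (F + c • G)) x = (K^[i] F) x + c * (K^[i] G) x := by
  have hkI := intervalIntegrable_of_abs_le_on_Icc hk hM
  subst hK
  induction i with
  | zero => intros; simp
  | succ i ih =>
    intro F G hF hG mF mG hmF hmG c x hx
    have h1 : ∀ ω : sphere (0 : EuclideanSpace ℝ (Fin 3)) 1,
        k ⟪x, (ω : EuclideanSpace ℝ (Fin 3))⟫_ℝ * ((fun (F : EuclideanSpace ℝ (Fin 3) → ℝ) (x : EuclideanSpace ℝ (Fin 3)) =>
          ∫ ω : sphere (0 : EuclideanSpace ℝ (Fin 3)) 1, k ⟪x, (ω : EuclideanSpace ℝ (Fin 3))⟫_ℝ * F ω ∂sphereMeasure)^[i]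
          (F + c • G)) ω =
        k ⟪x, (ω : EuclideanSpace ℝ (Fin 3))⟫_ℝ * ((fun (F : EuclideanSpace ℝ (Fin 3) → ℝ) (x : EuclideanSpace ℝ (Fin 3)) =>
          ∫ ω : sphere (0 : EuclideanSpace ℝ (Fin 3)) 1, k ⟪x, (ω : EuclideanSpace ℝ (Fin 3))⟫_ℝ * F ω ∂sphereMeasure)^[i] F) ω +
        c * (k ⟪x, (ω : EuclideanSpace ℝ (Fin 3))⟫_ℝ * ((fun (F : EuclideanSpace ℝ (Fin 3) → ℝ) (x : EuclideanSpace ℝ (Fin 3)) =>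
          ∫ ω : sphere (0 : EuclideanSpace ℝ (Fin 3)) 1, k ⟪x, (ω : EuclideanSpace ℝ (Fin 3))⟫_ℝ * F ω ∂sphereMeasure)^[i] G) ω) :=
      fun ω => by rw [ih hF hG hmF hmG c _ (by simp)]; ring
    rw [Function.iterate_succ_apply', Function.iterate_succ_apply', Function.iterate_succ_apply',
      integral_congr_ae (Eventually.of_forall h1), integral_add, integral_const_mul]
    · exact integrable_sphere_zonal_mul hx hkI (measurable_iterate_sphere_zonal hk hF i)
        (abs_iterate_sphere_zonal_le hkI hmF i)
    · exact (integrable_sphere_zonal_mul hx hkI (measurable_iterate_sphere_zonal hk hG i)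
        (abs_iterate_sphere_zonal_le hkI hmG i)).const_mul c

/-- **The iterates on finite Legendre sums**: on the unit sphere,
`K^i (Σ_{l<L} a_l P_l(⟪n, ·⟫)) = Σ_{l<L} a_l λ_l^i P_l(⟪n, ·⟫)`, `λ_l = 2π ∫_{-1}^{1} k P_l`
(`iterate_sphere_zonal_legendre` and linearity). [folklore] -/
theorem iterate_zonalOp_legendreSum (hk : Measurable k) (hM : ∀ t ∈ Icc (-1:ℝ) 1, |k t| ≤ M)
    {n : EuclideanSpace ℝ (Fin 3)} (hn : ‖n‖ = 1) (i : ℕ) (a : ℕ → ℝ) (L : ℕ) :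
    ∀ x : EuclideanSpace ℝ (Fin 3), ‖x‖ = 1 →
      (K^[i] (fun y => ∑ l ∈ Finset.range L, a l * (legendre l).eval ⟪n, y⟫_ℝ)) x =
        ∑ l ∈ Finset.range L, a l * ((2 * π * ∫ z in (-1:ℝ)..1, k z * (legendre l).eval z) ^ i *
          (legendre l).eval ⟪n, x⟫_ℝ) := by
  have hkI := intervalIntegrable_of_abs_le_on_Icc hk hM
  induction L with
  | zero =>
    intro x _
    simp only [Finset.range_zero, Finset.sum_empty]
    exact iterate_zonalOp_zero hK i x
  | succ L ih =>
    intro x hx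
    have hc : Continuous fun t : ℝ => ∑ l ∈ Finset.range L, a l * (legendre l).eval t :=
      continuous_finsetSum _ fun l _ => continuous_const.mul (legendre l).continuous
    obtain ⟨C, hC⟩ := exists_bound_comp_inner_sphere hc hn
    obtain ⟨C', hC'⟩ := exists_bound_comp_inner_sphere (legendre L).continuous hn
    have hFm : Measurable fun y : EuclideanSpace ℝ (Fin 3) => ∑ l ∈ Finset.range L, a l * (legendre l).eval ⟪n, y⟫_ℝ :=
      hc.measurable.comp (measurable_const.inner measurable_id)
    have hGm : Measurable fun y : EuclideanSpace ℝ (Fin 3) => (legendre L).eval ⟪n, y⟫_ℝ :=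
      (legendre L).continuous.measurable.comp (measurable_const.inner measurable_id)
    have hsplit : (fun y : EuclideanSpace ℝ (Fin 3) => ∑ l ∈ Finset.range (L + 1), a l * (legendre l).eval ⟪n, y⟫_ℝ) =
        (fun y => ∑ l ∈ Finset.range L, a l * (legendre l).eval ⟪n, y⟫_ℝ) +
          a L • fun y => (legendre L).eval ⟪n, y⟫_ℝ := by
      funext y
      simp only [Finset.sum_range_succ, Pi.add_apply, Pi.smul_apply, smul_eq_mul]
    rw [hsplit, iterate_zonalOp_add_smul hK hk hM i hFm hGm hC hC' (a L) x hx, ih x hx, Finset.sum_range_succ]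
    congr 1
    subst hK
    rw [iterate_sphere_zonal_legendre L hn hk hkI i hx, real_inner_comm x n]


end ZonalOp

/-! ### Registered helper -/

/-- **Registered helper `t12_legendre_series_L1` — the Legendre series of a bounded measurable function
converges in `L¹[-1, 1]`.** For `k : ℝ → ℝ` measurable with `|k| ≤ M` on `[-1, 1]`:
`∫_{-1}^{1} |k(t) − Σ_{ℓ<L} (2ℓ+1)/2 (∫_{-1}^{1} k P_ℓ) P_ℓ(t)| dt → 0` as `L → ∞` (`P_ℓ` the tree's Rodrigues
Legendre polynomials; `(2ℓ+1)/2 ∫ k P_ℓ = ⟨P̃_ℓ, k⟩ c_ℓ` the Fourier–Legendre coefficients). Completeness of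
the `P̃_ℓ` in `L²[-1, 1]` (`legendreBasis`) and `‖·‖_{L¹[-1,1]} ≤ √2 ‖·‖_{L²[-1,1]}`. This is the expansion of a
zonal weight that turns the Funk–Hecke multipliers `λ_ℓ = 2π∫ k P_ℓ` of the far-field calculus into `L¹(S²)`
kernel bounds (sibling file `…T12FarFieldContractionB`). [folklore] -/
theorem t12_legendre_series_L1 : ∀ (k : ℝ → ℝ) (M : ℝ), Measurable k → (∀ t ∈ Set.Icc (-1 : ℝ) 1, |k t| ≤ M) → Filter.Tendsto (fun L : ℕ => ∫ t in (-1 : ℝ)..1, |k t - ∑ l ∈ Finset.range L, (2 * (l : ℝ) + 1) / 2 * (∫ z in (-1 : ℝ)..1, k z * (Literature.Analysis.SpecialFunctions.legendre l).eval z) * (Literature.Analysis.SpecialFunctions.legendre l).eval t|) Filter.atTop (nhds 0) :=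
  fun _ _ hk hM => tendsto_integral_abs_sub_legendreSum hk hM

end Summit.AtomisticToContinuum.HydrodynamicLimit.Theorems.ClampedCorrectorBirth

end
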